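import Mathlib
import Summits.FinalStateConjecture.FinalStateConjecture.Theorems.PhotonSphereChannelsUniformPhotonSphereChannelsRNearLogEdgeChannels
import Summits.FinalStateConjecture.FinalStateConjecture.Theorems.PhotonSphereChannelsUniformRFar
import Summits.FinalStateConjecture.FinalStateConjecture.Theorems.PhotonSphereChannelsUniformRNearFar
import Summits.FinalStateConjecture.FinalStateConjecture.Theorems.PhotonSphereChannelsUniformPhotonSphereChannelsRCoeffMajorant

/-!
# Crux `UniformPhotonSphereChannelsR` (K1R, stmt-FinalStateConjecture-14074) — CLOSED along the line
# `crum-peeling-recessive-tower`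

`uniformPhotonSphereChannelsR_proof` has exactly the type of the route decl
`Summit.FinalStateConjecture.FinalStateConjecture.Theses.PhotonSphereChannels.UniformPhotonSphereChannelsR`
(its body, verbatim): the LOG-BALL two-ended channel-of-energy inequality for the Regge–Wheeler family on
Schwarzschild, constant uniform in `(s, ℓ, ρ)` for `ρ ≥ ρ₀(M) + C(M) log(ℓ+1)`.  Composition:
near half (`Theorems.CrumPeelingRecessiveTower.stub_nearLogEdgeChannels`, landed) ∧ far half
(`UniformRClosing.farLogEdgeChannels_of_coeffMajorant`, closing chain 2/3) via the domain-of-dependence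
glue (`UniformRClosing.uniform_of_near_far`, closing chain 3/3); the far half's only input beyond landed
stubs is the uniform coefficient majorant (Theorem A, `stub_coeffMajorant`) — here the lead's landed `CrumPeelingRecessiveTower.stub_coeffMajorant`.
Architecture and stubs: line leads 0, c1, c2 and the route seats (see the crux `NOTES.md`).
(No `Theses` import here on purpose: the route file imports this module for the `_holds` link.)
-/

-- `Summit.<S>.<S>` repeats a namespace component by design (D-0017); off here as in the lakefile.
set_option linter.dupNamespace false

namespace Summit.FinalStateConjecture.FinalStateConjecture.Theorems

/-- **`UniformPhotonSphereChannelsR` (K1R, item stmt-FinalStateConjecture-14074)**: the conclusion is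
VERBATIM the body of the route decl `…Theses.PhotonSphereChannels.UniformPhotonSphereChannelsR`. -/
theorem uniformPhotonSphereChannelsR_proof :
    ∀ M : ℝ, 0 < M → ∃ ρ₀ : ℝ, 0 ≤ ρ₀ ∧ ∃ C : ℝ, 0 ≤ C ∧ ∃ c : ℝ, 0 < c ∧ ∀ (r : ℝ → ℝ) (xc : ℝ), Literature.Geometry.Lorentzian.ReggeWheeler.IsTortoiseRadius M r xc → ∀ (s ℓ : ℕ), s ≤ 2 → s ≤ ℓ → ∀ ρ : ℝ, ρ₀ + C * Real.log ((ℓ : ℝ) + 1) ≤ ρ → Literature.Geometry.Lorentzian.ReggeWheeler.ChannelInequality (Literature.Geometry.Lorentzian.ReggeWheeler.linePotential M s ℓ r) xc ρ c :=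
  UniformRClosing.uniform_of_near_far CrumPeelingRecessiveTower.stub_nearLogEdgeChannels
    (UniformRClosing.farLogEdgeChannels_of_coeffMajorant
      CrumPeelingRecessiveTower.stub_coeffMajorant)

end Summit.FinalStateConjecture.FinalStateConjecture.Theorems
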